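import Summits.BirchSwinnertonDyer.BirchSwinnertonDyer.Theorems.PrintCf2RubinValueTwoColemanCoinvariantCharTraceArtin
import Summits.BirchSwinnertonDyer.BirchSwinnertonDyer.Theorems.PrintCf2RubinValueTwoColemanCoinvariantCharLiftable
import HarnessLib

/-!
# Brick (c) at `p = 2`, local `χ`-part, FOR THE ELLIPTIC UNITS ON THE `ℤ/d`-TRACE — an unramified tower of ARBITRARY degree `d·2^m`
# (the ray-class two-variable tower of `X₀(49)` has `d = 3`): **`char_Λ ((N_Σ / Col_Σ 𝒞̄_ell)_ε) = (L_ε)`**, abstract index type and LIFTABLE ideals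

Cell `bsd-print-cf2`, width seat `bsd-line-cf2c-w7` g17, route C `PrintCf2RubinValueTwo`, crux of record stmt-BirchSwinnertonDyer-24033
`TwoVariableMainConjAtSplitTwoQuad` (23720 nominal), BRICK §4(c); `--supports` the crux as a helper.  THEOREMS ONLY (0 sorry, no named fact
asserted, no definition); CONDITIONAL on the published named facts `DeShalit1987.prop24_ii/iii`, `prop25_i` carried as hypotheses by the
elliptic-unit files.  Theses-free.  BSD is not proved by any of this.

WHY (finding F6 of BRICK-C-DECOMP-g16).  The instantiated capstones `ColemanCoinvariantEllipticUnits.charIdeal_coinvariants_colemanImage_closure_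
ellipticUnits_eq_span` (g15 S32) and `ColemanCoinvariantEllipticUnitsLiftable.…_liftable_eq_span` (g16 S36) carry `[Unique (ZMod d)]`, i.e. a local
unramified tower `E_j` of degree `2^j` — but the global two-variable elliptic units live on the RAY CLASS fields `K(𝔤v'^{i+1}v^{k+1})` with `𝔣 ∣ 𝔤`,
whose completed tower at `𝔓 ∣ v` has `[E_j : K_v] = d·2^j` with `d = 3` for `X₀(49)` (`π ↦ 4` has order `3` in `(𝓞/√−7)^×`; S40's `f ∣ d`).  For the
quadratic branches only the part of `Λ(𝒢)` trivial under `ℤ/d` matters, reached for every `d` by the `ℤ/d`-trace `Σ` (`Σ ∘ Col = Col ∘ N_{ℤ/d}` on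
units).  THIS file is S32/S36 verbatim on the trace (`PrintCf2RubinValueTwoColemanCoinvariantCharTraceArtin`), `[Unique (ZMod d)]` removed:

* §1 ★★★ **`charIdeal_coinvariants_colemanImageTrace_closure_ellipticUnits_eq_span`** — abstract index type `(I, idl, μ)`, theta families, local
  Artin lifts, (G) `happrox`, (A) `a₁`/`a₂`, (L) `L_ε ≠ 0`;
* §2 ★★★ **`charIdeal_coinvariants_colemanImageTrace_closure_ellipticUnits_liftable_eq_span`** — index type := the liftable ideals
  (`IsLocArtinLiftable`), (G) DISCHARGED by `happrox_of_isLocArtinLiftable`; remaining: local frame + tower data (all of them from ONE `α` by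
  `RayClassFieldTwoVariableTowerData`, now with `d = 3` admissible), theta families, any local lifts, (A), (L).

## References
* [deShalit1987] E. de Shalit, *Iwasawa theory of elliptic curves with complex multiplication* (1987), II §1.10, §2.4 (ii), §4.12, §4.14;
  III §1.3, §1.4 (5), Cor. 1.5 (7), Lemma 1.10 (17).
* [NeukirchANT1999] J. Neukirch, *Algebraic Number Theory* (1999), Ch. VI §5 Prop. (5.6), §7 Thm. (7.1).
* [SerreLocalFields1979] J.-P. Serre, *Local Fields* (1979), Ch. II §4 Prop. 8.
-/

noncomputable section

set_option linter.dupNamespace false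
set_option autoImplicit false

open Filter Topology
open scoped PowerSeries.WithPiTopology
open scoped NumberField Classical

namespace Summit.BirchSwinnertonDyer.BirchSwinnertonDyer.Theorems.PrintCf2.ColemanCoinvariantTraceEllipticUnits

open Field IsDedekindDomain IsDedekindDomain.HeightOneSpectrum ValuativeRel
open Literature.NumberTheory.NumberFields
open Literature.NumberTheory.GaloisRepresentations Literature.NumberTheory.GaloisRepresentations.IsNonarchimedeanLocalField
  Literature.NumberTheory.GaloisRepresentations.LubinTate Literature.NumberTheory.GaloisRepresentations.ArtinLocalGlobal
open Literature.NumberTheory.EllipticCurves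
open Literature.NumberTheory.ComplexMultiplication.EllipticUnits
open Literature.NumberTheory.LFunctions.AbelianDensity (artinSymbol)
open Literature.RingTheory.PowerSeries (maxEval)
open Summit.BirchSwinnertonDyer.BirchSwinnertonDyer.Theorems.PrintCf2.ColemanImage
open Summit.BirchSwinnertonDyer.BirchSwinnertonDyer.Theorems.PrintCf2.ColemanCoinvariantGalois
open Summit.BirchSwinnertonDyer.BirchSwinnertonDyer.Theorems.PrintCf2.ColemanCoinvariantArtin
open Summit.BirchSwinnertonDyer.BirchSwinnertonDyer.Theorems.PrintCf2.EllipticUnitsLocal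
open Summit.BirchSwinnertonDyer.BirchSwinnertonDyer.Theorems.PrintCf2.EllipticUnitsLocal₂
open Summit.BirchSwinnertonDyer.BirchSwinnertonDyer.Theorems.PrintCf2.ColemanCoinvariantEllipticUnits
open Summit.BirchSwinnertonDyer.BirchSwinnertonDyer.Theorems.PrintCf2.ColemanCoinvariantTrace
open Summit.BirchSwinnertonDyer.BirchSwinnertonDyer.Theorems.PrintCf2.ColemanCoinvariantTraceArtin

variable {K : Type} [Field K] [NumberField K] {𝔤 : Ideal (𝓞 K)} {v v' : HeightOneSpectrum (𝓞 K)}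

attribute [local instance] ltNormUniformSpace ltNormIsUniformAddGroup rk1 nF nE fintypeResidueField
attribute [local instance] RelNormCoherentUnits.instCommMonoid

/-! ## §1. The (c)-capstone on the trace for the elliptic units (abstract index type) -/

section Capstone

attribute [local instance] isAdicComplete_maximalIdeal_powerSeries_integer

variable [NumberField.IsTotallyComplex K]
  (h24iii : DeShalit1987.prop24_iii_unit) (h25 : DeShalit1987.prop25_i_normRelation) (h24ii : DeShalit1987.prop24_ii_galoisAction)
  (hK : IsImaginaryQuadratic K) (ιK : K →+* ℂ)
  (h𝔤0 : 𝔤 ≠ ⊥) (hv : ¬ 𝔤 ≤ v.asIdeal) (hvv' : v' ≠ v) (hw : ∀ u : (𝓞 K)ˣ, (u : 𝓞 K) - 1 ∈ 𝔤 * v'.asIdeal → u = 1)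
  {π : 𝒪[v.adicCompletion K]} (hπ : (valuation (v.adicCompletion K)).IsUniformizer (π : v.adicCompletion K))
  {α : ℕ → 𝓞 K} (hα0 : ∀ i, α i ≠ 0) (hα𝔪 : ∀ i, α i - 1 ∈ 𝔤 * v'.asIdeal ^ (i + 1))
  (hαw : ∀ i, ∀ w : HeightOneSpectrum (𝓞 K), w ≠ v → α i ∉ w.asIdeal)
  {f : ℕ → ℕ} (hαπ : ∀ i, ((α i : K) : v.adicCompletion K) = (π : v.adicCompletion K) ^ f i)
  [CharZero (v.adicCompletion K)]
  -- the local two-variable frame of the (c)-chain (ANY `d`: the identity is read on the `ℤ/d`-trace)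
  {p : ℕ} [hp : Fact p.Prime] {d : ℕ} (hd : d.Coprime p)
  (E : ℕ → IntermediateField (v.adicCompletion K) (AlgebraicClosure (v.adicCompletion K)))
  [∀ j, FiniteDimensional (v.adicCompletion K) (E j)] [∀ j, Normal (v.adicCompletion K) (E j)] [∀ j, IsGalois (v.adicCompletion K) (E j)]
  (hmono : Monotone E) (hE : ∀ j, E j ≤ maxUnramified (v.adicCompletion K)) (hdeg : ∀ j, Module.finrank (v.adicCompletion K) (E j) = d * p ^ j)
  {σ₀ : absoluteGaloisGroup (v.adicCompletion K)} (hσ₀ : IsAbsArithFrob σ₀) (hq : residueFieldCard (v.adicCompletion K) = 2)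
  (u : (LTCoeff (v.adicCompletion K))ˣ) (hu : LTCoeff.of (v.adicCompletion K) π = residueFieldCard (v.adicCompletion K) * u)
  (γ w : 𝒪[v.adicCompletion K]ˣ) (hγ : (γ : 𝒪[v.adicCompletion K]) = 1 + π ^ 2 * w)
  [IsAdicComplete (Ideal.span {intBase (v.adicCompletion K) (LTCoeff.of (v.adicCompletion K) π)}) (PowerSeries 𝒪[v.adicCompletion K])]
  [NeZero d]
  {θ : ∀ j, unitBall (E j)} (hθ : ∀ j, IsIntegralNormalGen (E j) (θ j))
  (hcoh : ∀ j, unitBallTrace (hmono (Nat.le_succ j)) (θ (j + 1)) = θ j)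
  [IsAdicComplete (Ideal.span {(p : 𝒪[v.adicCompletion K])}) 𝒪[v.adicCompletion K]]
  (hI : Ideal.span {(p : 𝒪[v.adicCompletion K])} ≠ ⊤)
  (hud : ∀ j, (u : LTCoeff (v.adicCompletion K)) ^ Module.finrank (v.adicCompletion K) (E j) ≠ 1)
  (hm : ∃ m₁ : ℕ, LTCoeff.of (v.adicCompletion K) π ^ 2 ∣ LTCoeff.of (v.adicCompletion K) π - m₁)
  (hN : DenseRange (Nat.cast : ℕ → 𝒪[v.adicCompletion K]))
  -- the unramified offset and the containment data on the shifted levels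
  (c : ℕ)
  (hdegEc : ∀ i, ∀ w' : WeilGroup (v.adicCompletion K),
    WeilGroup.toAbsGalois (v.adicCompletion K) w' ∈ (E (i + c)).fixingSubgroup → (f i : ℤ) ∣ WeilGroup.deg w')
  (hinert : ∀ i, ∀ τ : absoluteGaloisGroup (v.adicCompletion K),
    (∀ y ∈ rayClassField K (𝔤 * v'.asIdeal ^ (i + 1 + 1)),
      τ • absClosureEmbedding K (v.adicCompletion K) y = absClosureEmbedding K (v.adicCompletion K) y) →
      τ ∈ (E (i + 1 + c)).fixingSubgroup)
  (hcount : ∀ i k : ℕ, IntermediateField.relfinrank (rayClassField K (𝔤 * v'.asIdeal ^ (i + 1) * v.asIdeal ^ (k + 1)))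
      (rayClassField K (𝔤 * v'.asIdeal ^ (i + 1 + 1) * v.asIdeal ^ (k + 1))) * Module.finrank (v.adicCompletion K) (E (i + c)) ≤
      Module.finrank (v.adicCompletion K) (E (i + 1 + c)))
  -- the index type
  {I : Type*} (idl : I → Ideal (𝓞 K)) (μ : I → I → I) (hμidl : ∀ a b, idl (μ a b) = idl a * idl b)
  (hidl0 : ∀ a, idl a ≠ ⊥) (hidlc : ∀ a, IsCoprime (idl a) (𝔤 * v.asIdeal * v'.asIdeal))
  (x : ∀ a : I, ∀ i k : ℕ, rayClassField K (𝔤 * v'.asIdeal ^ (i + 1) * v.asIdeal ^ (k + 1)))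
  (hx : ∀ a, ∀ i k : ℕ, IsThetaValueOne ιK (𝔤 * v'.asIdeal ^ (i + 1) * v.asIdeal ^ (k + 1)) (idl a)
    (algClosureEmb ιK ((x a i k : rayClassField K (𝔤 * v'.asIdeal ^ (i + 1) * v.asIdeal ^ (k + 1))) : AlgebraicClosure K)))
  (σ : I → absoluteGaloisGroup (v.adicCompletion K))
  (hσ : ∀ a, ∀ i k : ℕ, absRestrictNormalHom (rayClassField K (𝔤 * v'.asIdeal ^ (i + 1) * v.asIdeal ^ (k + 1)))
      (absGaloisRestrict K (v.adicCompletion K) (σ a)) =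
    artinSymbol (galFrob K (rayClassField K (𝔤 * v'.asIdeal ^ (i + 1) * v.asIdeal ^ (k + 1)))) (idl a))
  -- (G) layer-approximation
  (happrox : ∀ (τ : absoluteGaloisGroup (v.adicCompletion K)) (N : ℕ), ∃ a : I,
    ∀ z : (E N ⊔ ltField π N : IntermediateField (v.adicCompletion K) (AlgebraicClosure (v.adicCompletion K))),
      σ a • (z : AlgebraicClosure (v.adicCompletion K)) = τ • (z : AlgebraicClosure (v.adicCompletion K)))
  (ε : PowerSeries (PowerSeries 𝒪[v.adicCompletion K])) (g : I → (PowerSeries 𝒪[v.adicCompletion K])ˣ)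

include h24ii hμidl hσ hm in
/-- ★★★ **THE LOCAL (c)-IDENTITY FOR THE ELLIPTIC UNITS ON THE `ℤ/d`-TRACE, ANY `d`** (de Shalit III Lemma 1.10 (17) at `q = 2`, one prime above `v`,
`χ` trivial on the prime-to-`2` torsion `ℤ/d`, `χ(−1) = ε`): let
`⟨e(𝔞_a)⟩ ∈ 𝒰¹_∞` (`a ∈ I`, ideals closed under `μ`, prime to `𝔤vv'`) be the principal two-variable elliptic units at `𝔓` (theta families `x_a`, GIVEN
II.2.4 (i)–(iii), II.2.5 (i)), `σ̃_a ∈ Γ_{K_v}` local lifts of the Artin symbols of `𝔞_a` at every level `K(𝔤v'^{i+1}v^{k+1})`, and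
`𝒞̄_ell := closure ⟨⟨e(𝔞_a)⟩^{±1}⟩`.  GIVEN (G) the `σ̃_a` approximate every `τ ∈ Γ_{K_v}` on every layer `E_N·K_π^{N+1}`, (A) `χ_π(σ̃_{a₁}) = γ`,
`b = N𝔞_{a₁} g_{a₁}⁻¹ − 1 ∈ 𝔪`, one `a₂` with non-zero Weierstrass value, and (L) `L_ε ≠ 0` with `φ_ε(Σ_j Col ⟨e(𝔞_a)⟩(j)) = (t_{χ(σ̃_a)}·C g_a − C N𝔞_a)·L_ε`:
**`char_Λ ((N_Σ / Col_Σ 𝒞̄_ell)_ε) = (L_ε)`** — the trace capstone `charIdeal_coinvariants_colemanImageTrace_closure_eq_span_of_mul_rule` with its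
unit-side inputs `hβ` (principal coherent) and `hrule` (product rule) DISCHARGED; for the ray-class two-variable tower of `X₀(49)` (`d = 3`) this is
the first instantiable form.
[cite: deShalit1987, II §2.4 (ii), §4.12 (33), §4.14; III §1.3, §1.4 (5), Cor. 1.5 (7), Lemma 1.10 (17)] [cite: SerreLocalFields1979, Ch. II §4 Prop. 8] -/
theorem charIdeal_coinvariants_colemanImageTrace_closure_ellipticUnits_eq_span (hε : ε * ε = 1)
    (a₁ a₂ : I) (hv₁ : lubinTateChar hπ (σ a₁) = γ)
    (hn₁ : ((Ideal.absNorm (idl a₁) : ℕ) : PowerSeries 𝒪[v.adicCompletion K]) * ((g a₁)⁻¹ : (PowerSeries 𝒪[v.adicCompletion K])ˣ) - 1 ∈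
      IsLocalRing.maximalIdeal (PowerSeries 𝒪[v.adicCompletion K]))
    (ha₂ : maxEval hn₁ (colemanDeltaCoinvFun hπ hq (intBase (v.adicCompletion K)) u hu γ (eq_zero_of_C_pi_mul_eq_zero_integer hπ) w hγ ε
        (unitTwistₗ hπ hq (intBase (v.adicCompletion K)) u hu γ (lubinTateChar hπ (σ a₂)) (TActModule.ofPS _ _ 1)) -
      PowerSeries.C (((Ideal.absNorm (idl a₂) : ℕ) : PowerSeries 𝒪[v.adicCompletion K]) *
        ((g a₂)⁻¹ : (PowerSeries 𝒪[v.adicCompletion K])ˣ))) ≠ 0)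
    (L : PowerSeries (PowerSeries 𝒪[v.adicCompletion K])) (hL0 : L ≠ 0)
    (hL : ∀ b : I, colemanDeltaCoinvFun hπ hq (intBase (v.adicCompletion K)) u hu γ (eq_zero_of_C_pi_mul_eq_zero_integer hπ) w hγ ε
        (indexTraceₗ hπ hq u hu γ (colemanImage hd hπ E hmono hE hdeg hσ₀ hq u hu γ hθ hcoh
          (closure_unitsGen_subset_principalCoherentFamilies hπ E hmono
            (fun b ↦ ellipticUnitsPrincipal₂ h24iii h25 hK ιK h𝔤0 hv hvv' hw hπ hα0 hα𝔪 hαw hαπ E hmono c (fun i ↦ hE (i + c)) hdegEc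
              (hidl0 b) (hidlc b) (x b) (hx b))
            (fun b ↦ ellipticUnitsPrincipal₂_mem_principalCoherentFamilies h24iii h25 hK ιK h𝔤0 hv hvv' hw hπ hα0 hα𝔪 hαw hαπ E hmono c
              (fun i ↦ hE (i + c)) hdegEc (hidl0 b) (hidlc b) hinert hcount (x b) (hx b))
            (mem_closure_unitsGen hπ E _ b)).1)) =
      (colemanDeltaCoinvFun hπ hq (intBase (v.adicCompletion K)) u hu γ (eq_zero_of_C_pi_mul_eq_zero_integer hπ) w hγ ε
          (unitTwistₗ hπ hq (intBase (v.adicCompletion K)) u hu γ (lubinTateChar hπ (σ b)) (TActModule.ofPS _ _ 1)) *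
          PowerSeries.C (g b : PowerSeries 𝒪[v.adicCompletion K]) - PowerSeries.C ((Ideal.absNorm (idl b) : ℕ) : PowerSeries 𝒪[v.adicCompletion K])) * L) :
    Module.charIdeal (PowerSeries (PowerSeries 𝒪[v.adicCompletion K]))
        (↥(unitsImageTrace hd hπ E hmono hE hdeg hσ₀ hq u hu γ hθ hcoh hI hud) ⧸
          colemanCoinvRel hπ hq (intBase (v.adicCompletion K)) u hu γ ε (unitsImageTrace hd hπ E hmono hE hdeg hσ₀ hq u hu γ hθ hcoh hI hud)
            (fun _ hG => unitTwistₗ_mem_unitsImageTrace hd hπ E hmono hE hdeg hσ₀ hq u hu γ hθ hcoh hI hud (-1) hG)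
            (colemanImageTrace hd hπ E hmono hE hdeg hσ₀ hq u hu γ hθ hcoh hN
              (closure (Submonoid.closure
                (Set.range (fun b ↦ ellipticUnitsPrincipal₂ h24iii h25 hK ιK h𝔤0 hv hvv' hw hπ hα0 hα𝔪 hαw hαπ E hmono c (fun i ↦ hE (i + c))
                  hdegEc (hidl0 b) (hidlc b) (x b) (hx b)) ∪
                  Set.range fun b ↦ fun j ↦ (ellipticUnitsPrincipal₂ h24iii h25 hK ιK h𝔤0 hv hvv' hw hπ hα0 hα𝔪 hαw hαπ E hmono c
                    (fun i ↦ hE (i + c)) hdegEc (hidl0 b) (hidlc b) (x b) (hx b) j).inv hπ (E j)) :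
                Set (∀ j, RelNormCoherentUnits hπ (E j))))
              isClosed_closure
              (closure_unitsGen_subset_principalCoherentFamilies hπ E hmono _
                (fun b ↦ ellipticUnitsPrincipal₂_mem_principalCoherentFamilies h24iii h25 hK ιK h𝔤0 hv hvv' hw hπ hα0 hα𝔪 hαw hαπ E hmono c
                  (fun i ↦ hE (i + c)) hdegEc (hidl0 b) (hidlc b) hinert hcount (x b) (hx b)))
              (one_mem_closure_unitsGen hπ E _) (mul_mem_closure_unitsGen hπ E _) (inv_mem_closure_unitsGen hπ E _)
              (galAct_mem_closure_unitsGen hπ E _ (galAct_mem_closure_unitsGen_of_mul_rule hπ E hmono _ σ happrox μ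
                (fun b ↦ Ideal.absNorm (idl b))
                (hrule_ellipticUnitsPrincipal₂ h24iii h25 hK ιK h𝔤0 hv hvv' hw hπ hα0 hα𝔪 hαw hαπ E hmono c (fun i ↦ hE (i + c)) hdegEc h24ii
                  idl μ hμidl hidl0 hidlc x hx σ hσ))))) =
      Ideal.span {L} :=
  charIdeal_coinvariants_colemanImageTrace_closure_eq_span_of_mul_rule hd hπ E hmono hE hdeg hσ₀ hq u hu γ w hγ hθ hcoh hI hud hm hN
    (fun b ↦ ellipticUnitsPrincipal₂ h24iii h25 hK ιK h𝔤0 hv hvv' hw hπ hα0 hα𝔪 hαw hαπ E hmono c (fun i ↦ hE (i + c)) hdegEc (hidl0 b) (hidlc b)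
      (x b) (hx b))
    (fun b ↦ ellipticUnitsPrincipal₂_mem_principalCoherentFamilies h24iii h25 hK ιK h𝔤0 hv hvv' hw hπ hα0 hα𝔪 hαw hαπ E hmono c
      (fun i ↦ hE (i + c)) hdegEc (hidl0 b) (hidlc b) hinert hcount (x b) (hx b))
    ε σ g (fun b ↦ Ideal.absNorm (idl b)) μ
    (hrule_ellipticUnitsPrincipal₂ h24iii h25 hK ιK h𝔤0 hv hvv' hw hπ hα0 hα𝔪 hαw hαπ E hmono c (fun i ↦ hE (i + c)) hdegEc h24ii idl μ hμidl
      hidl0 hidlc x hx σ hσ)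
    happrox hε a₁ a₂ hv₁ hn₁ ha₂ L hL0 hL

end Capstone

/-! ## §2. The (c)-capstone on the trace for the elliptic units indexed by the LIFTABLE ideals ((G) discharged) -/

section CapstoneLiftable

attribute [local instance] isAdicComplete_maximalIdeal_powerSeries_integer

variable [NumberField.IsTotallyComplex K]
  (h24iii : DeShalit1987.prop24_iii_unit) (h25 : DeShalit1987.prop25_i_normRelation) (h24ii : DeShalit1987.prop24_ii_galoisAction)
  (hK : IsImaginaryQuadratic K) (ιK : K →+* ℂ)
  (h𝔤0 : 𝔤 ≠ ⊥) (hv : ¬ 𝔤 ≤ v.asIdeal) (hvv' : v' ≠ v) (hw : ∀ u : (𝓞 K)ˣ, (u : 𝓞 K) - 1 ∈ 𝔤 * v'.asIdeal → u = 1)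
  {π : 𝒪[v.adicCompletion K]} (hπ : (valuation (v.adicCompletion K)).IsUniformizer (π : v.adicCompletion K))
  {α : ℕ → 𝓞 K} (hα0 : ∀ i, α i ≠ 0) (hα𝔪 : ∀ i, α i - 1 ∈ 𝔤 * v'.asIdeal ^ (i + 1))
  (hαw : ∀ i, ∀ w : HeightOneSpectrum (𝓞 K), w ≠ v → α i ∉ w.asIdeal)
  {f : ℕ → ℕ} (hαπ : ∀ i, ((α i : K) : v.adicCompletion K) = (π : v.adicCompletion K) ^ f i)
  [CharZero (v.adicCompletion K)]
  -- the local two-variable frame of the (c)-chain (ANY `d`: the identity is read on the `ℤ/d`-trace)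
  {p : ℕ} [hp : Fact p.Prime] {d : ℕ} (hd : d.Coprime p)
  (E : ℕ → IntermediateField (v.adicCompletion K) (AlgebraicClosure (v.adicCompletion K)))
  [∀ j, FiniteDimensional (v.adicCompletion K) (E j)] [∀ j, Normal (v.adicCompletion K) (E j)] [∀ j, IsGalois (v.adicCompletion K) (E j)]
  (hmono : Monotone E) (hE : ∀ j, E j ≤ maxUnramified (v.adicCompletion K)) (hdeg : ∀ j, Module.finrank (v.adicCompletion K) (E j) = d * p ^ j)
  {σ₀ : absoluteGaloisGroup (v.adicCompletion K)} (hσ₀ : IsAbsArithFrob σ₀) (hq : residueFieldCard (v.adicCompletion K) = 2)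
  (u : (LTCoeff (v.adicCompletion K))ˣ) (hu : LTCoeff.of (v.adicCompletion K) π = residueFieldCard (v.adicCompletion K) * u)
  (γ w : 𝒪[v.adicCompletion K]ˣ) (hγ : (γ : 𝒪[v.adicCompletion K]) = 1 + π ^ 2 * w)
  [IsAdicComplete (Ideal.span {intBase (v.adicCompletion K) (LTCoeff.of (v.adicCompletion K) π)}) (PowerSeries 𝒪[v.adicCompletion K])]
  [NeZero d]
  {θ : ∀ j, unitBall (E j)} (hθ : ∀ j, IsIntegralNormalGen (E j) (θ j))
  (hcoh : ∀ j, unitBallTrace (hmono (Nat.le_succ j)) (θ (j + 1)) = θ j)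
  [IsAdicComplete (Ideal.span {(p : 𝒪[v.adicCompletion K])}) 𝒪[v.adicCompletion K]]
  (hI : Ideal.span {(p : 𝒪[v.adicCompletion K])} ≠ ⊤)
  (hud : ∀ j, (u : LTCoeff (v.adicCompletion K)) ^ Module.finrank (v.adicCompletion K) (E j) ≠ 1)
  (hm : ∃ m₁ : ℕ, LTCoeff.of (v.adicCompletion K) π ^ 2 ∣ LTCoeff.of (v.adicCompletion K) π - m₁)
  (hN : DenseRange (Nat.cast : ℕ → 𝒪[v.adicCompletion K]))
  -- the unramified offset and the containment data on the shifted levels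
  (c : ℕ)
  (hdegEc : ∀ i, ∀ w' : WeilGroup (v.adicCompletion K),
    WeilGroup.toAbsGalois (v.adicCompletion K) w' ∈ (E (i + c)).fixingSubgroup → (f i : ℤ) ∣ WeilGroup.deg w')
  -- INERT from level 0 (the form of `RayClassFieldTwoVariableLayerApproximation`; the capstone's `hinert` is its shift)
  (hinert₀ : ∀ i, ∀ τ : absoluteGaloisGroup (v.adicCompletion K),
    (∀ y ∈ rayClassField K (𝔤 * v'.asIdeal ^ (i + 1)),
      τ • absClosureEmbedding K (v.adicCompletion K) y = absClosureEmbedding K (v.adicCompletion K) y) →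
      τ ∈ (E (i + c)).fixingSubgroup)
  (hcount : ∀ i k : ℕ, IntermediateField.relfinrank (rayClassField K (𝔤 * v'.asIdeal ^ (i + 1) * v.asIdeal ^ (k + 1)))
      (rayClassField K (𝔤 * v'.asIdeal ^ (i + 1 + 1) * v.asIdeal ^ (k + 1))) * Module.finrank (v.adicCompletion K) (E (i + c)) ≤
      Module.finrank (v.adicCompletion K) (E (i + 1 + c)))
  -- the index type: the LIFTABLE ideals (`RayClassFieldTwoVariableDecomposition.IsLocArtinLiftable`), theta families, local lifts
  (x : ∀ a : {𝔞 : Ideal (𝓞 K) // IsLocArtinLiftable 𝔤 v v' 𝔞}, ∀ i k : ℕ,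
    rayClassField K (𝔤 * v'.asIdeal ^ (i + 1) * v.asIdeal ^ (k + 1)))
  (hx : ∀ a, ∀ i k : ℕ, IsThetaValueOne ιK (𝔤 * v'.asIdeal ^ (i + 1) * v.asIdeal ^ (k + 1)) (a.1 : Ideal (𝓞 K))
    (algClosureEmb ιK ((x a i k : rayClassField K (𝔤 * v'.asIdeal ^ (i + 1) * v.asIdeal ^ (k + 1))) : AlgebraicClosure K)))
  (σ : {𝔞 : Ideal (𝓞 K) // IsLocArtinLiftable 𝔤 v v' 𝔞} → absoluteGaloisGroup (v.adicCompletion K))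
  (hσ : ∀ a, ∀ i k : ℕ, absRestrictNormalHom (rayClassField K (𝔤 * v'.asIdeal ^ (i + 1) * v.asIdeal ^ (k + 1)))
      (absGaloisRestrict K (v.adicCompletion K) (σ a)) =
    artinSymbol (galFrob K (rayClassField K (𝔤 * v'.asIdeal ^ (i + 1) * v.asIdeal ^ (k + 1)))) (a.1 : Ideal (𝓞 K)))
  (ε : PowerSeries (PowerSeries 𝒪[v.adicCompletion K]))
  (g : {𝔞 : Ideal (𝓞 K) // IsLocArtinLiftable 𝔤 v v' 𝔞} → (PowerSeries 𝒪[v.adicCompletion K])ˣ)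


include h24ii hσ hm hmono hcount hinert₀ in
/-- ★★★ **THE LOCAL (c)-IDENTITY FOR THE ELLIPTIC UNITS ON THE `ℤ/d`-TRACE, ANY `d`, INPUT (G) DISCHARGED** (de Shalit III Lemma 1.10 (17) at
`q = 2`, one prime above `v`, `χ` trivial on `ℤ/d`, `χ(−1) = ε`): index the principal two-variable elliptic units `⟨e(𝔞)⟩ ∈ 𝒰¹_∞` by the LIFTABLE ideals
`I = {𝔞 ≠ 0 prime to 𝔤vv' : (𝔞, K(𝔤v'^{n+1}v^{n+1})/K) ∈ D_𝔓 for all n}` (`IsLocArtinLiftable`, de Shalit's `σ_𝔞 ∈ D`; closed under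
products), with theta families `x_a` (GIVEN II.2.4 (i)–(iii), II.2.5 (i)) and ANY local lifts `σ̃_a ∈ Γ_{K_v}` of their Artin symbols
(`hσ`; such lifts exist: `exists_localLift_of_isLocArtinLiftable`), `𝒞̄_ell := closure ⟨⟨e(𝔞_a)⟩^{±1}⟩`.  The layer-approximation (G)
of the capstone — «the `σ̃_a` approximate every `τ ∈ Γ_{K_v}` on every `E_N·K_π^{N+1}`» — now FOLLOWS from the local tower data
(`RayClassFieldTwoVariableDecomposition.happrox_of_isLocArtinLiftable`: the decomposition group is open and the Artin symbols of
integral ideals fill every layer).  GIVEN (A) `χ_π(σ̃_{a₁}) = γ`, `b = N𝔞_{a₁} g_{a₁}⁻¹ − 1 ∈ 𝔪`, one `a₂` with non-zero Weierstrass value,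
and (L) `L_ε ≠ 0` with `φ_ε(Σ_j Col ⟨e(𝔞_a)⟩(j)) = (t_{χ(σ̃_a)}·C g_a − C N𝔞_a)·L_ε`: **`char_Λ ((N_Σ / Col_Σ 𝒞̄_ell)_ε) = (L_ε)`** — the trace
capstone `charIdeal_coinvariants_colemanImageTrace_closure_ellipticUnits_eq_span` with `hβ`, `hrule` AND `happrox` discharged.
[cite: deShalit1987, II §1.10, §2.4 (ii), §4.12 (33), §4.14; III §1.3, §1.4 (5), Cor. 1.5 (7), Lemma 1.10 (17)]
[cite: NeukirchANT1999, Ch. VI §5 Prop. (5.6), §7 Thm. (7.1)] [cite: SerreLocalFields1979, Ch. II §4 Prop. 8] -/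
theorem charIdeal_coinvariants_colemanImageTrace_closure_ellipticUnits_liftable_eq_span (hε : ε * ε = 1)
    (a₁ a₂ : {𝔞 : Ideal (𝓞 K) // IsLocArtinLiftable 𝔤 v v' 𝔞}) (hv₁ : lubinTateChar hπ (σ a₁) = γ)
    (hn₁ : ((Ideal.absNorm (a₁.1 : Ideal (𝓞 K)) : ℕ) : PowerSeries 𝒪[v.adicCompletion K]) * ((g a₁)⁻¹ : (PowerSeries 𝒪[v.adicCompletion K])ˣ) - 1 ∈
      IsLocalRing.maximalIdeal (PowerSeries 𝒪[v.adicCompletion K]))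
    (ha₂ : maxEval hn₁ (colemanDeltaCoinvFun hπ hq (intBase (v.adicCompletion K)) u hu γ (eq_zero_of_C_pi_mul_eq_zero_integer hπ) w hγ ε
        (unitTwistₗ hπ hq (intBase (v.adicCompletion K)) u hu γ (lubinTateChar hπ (σ a₂)) (TActModule.ofPS _ _ 1)) -
      PowerSeries.C (((Ideal.absNorm (a₂.1 : Ideal (𝓞 K)) : ℕ) : PowerSeries 𝒪[v.adicCompletion K]) *
        ((g a₂)⁻¹ : (PowerSeries 𝒪[v.adicCompletion K])ˣ))) ≠ 0)
    (L : PowerSeries (PowerSeries 𝒪[v.adicCompletion K])) (hL0 : L ≠ 0)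
    (hL : ∀ b : {𝔞 : Ideal (𝓞 K) // IsLocArtinLiftable 𝔤 v v' 𝔞}, colemanDeltaCoinvFun hπ hq (intBase (v.adicCompletion K)) u hu γ (eq_zero_of_C_pi_mul_eq_zero_integer hπ) w hγ ε
        (indexTraceₗ hπ hq u hu γ (colemanImage hd hπ E hmono hE hdeg hσ₀ hq u hu γ hθ hcoh
          (closure_unitsGen_subset_principalCoherentFamilies hπ E hmono
            (fun b ↦ ellipticUnitsPrincipal₂ h24iii h25 hK ιK h𝔤0 hv hvv' hw hπ hα0 hα𝔪 hαw hαπ E hmono c (fun i ↦ hE (i + c)) hdegEc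
              b.2.1 b.2.2.1 (x b) (hx b))
            (fun b ↦ ellipticUnitsPrincipal₂_mem_principalCoherentFamilies h24iii h25 hK ιK h𝔤0 hv hvv' hw hπ hα0 hα𝔪 hαw hαπ E hmono c
              (fun i ↦ hE (i + c)) hdegEc b.2.1 b.2.2.1 (fun i ↦ hinert₀ (i + 1)) hcount (x b) (hx b))
            (mem_closure_unitsGen hπ E _ b)).1)) =
      (colemanDeltaCoinvFun hπ hq (intBase (v.adicCompletion K)) u hu γ (eq_zero_of_C_pi_mul_eq_zero_integer hπ) w hγ ε
          (unitTwistₗ hπ hq (intBase (v.adicCompletion K)) u hu γ (lubinTateChar hπ (σ b)) (TActModule.ofPS _ _ 1)) *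
          PowerSeries.C (g b : PowerSeries 𝒪[v.adicCompletion K]) - PowerSeries.C ((Ideal.absNorm (b.1 : Ideal (𝓞 K)) : ℕ) : PowerSeries 𝒪[v.adicCompletion K])) * L) :
    Module.charIdeal (PowerSeries (PowerSeries 𝒪[v.adicCompletion K]))
        (↥(unitsImageTrace hd hπ E hmono hE hdeg hσ₀ hq u hu γ hθ hcoh hI hud) ⧸
          colemanCoinvRel hπ hq (intBase (v.adicCompletion K)) u hu γ ε (unitsImageTrace hd hπ E hmono hE hdeg hσ₀ hq u hu γ hθ hcoh hI hud)
            (fun _ hG => unitTwistₗ_mem_unitsImageTrace hd hπ E hmono hE hdeg hσ₀ hq u hu γ hθ hcoh hI hud (-1) hG)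
            (colemanImageTrace hd hπ E hmono hE hdeg hσ₀ hq u hu γ hθ hcoh hN
              (closure (Submonoid.closure
                (Set.range (fun b ↦ ellipticUnitsPrincipal₂ h24iii h25 hK ιK h𝔤0 hv hvv' hw hπ hα0 hα𝔪 hαw hαπ E hmono c (fun i ↦ hE (i + c))
                  hdegEc b.2.1 b.2.2.1 (x b) (hx b)) ∪
                  Set.range fun b ↦ fun j ↦ (ellipticUnitsPrincipal₂ h24iii h25 hK ιK h𝔤0 hv hvv' hw hπ hα0 hα𝔪 hαw hαπ E hmono c
                    (fun i ↦ hE (i + c)) hdegEc b.2.1 b.2.2.1 (x b) (hx b) j).inv hπ (E j)) :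
                Set (∀ j, RelNormCoherentUnits hπ (E j))))
              isClosed_closure
              (closure_unitsGen_subset_principalCoherentFamilies hπ E hmono _
                (fun b ↦ ellipticUnitsPrincipal₂_mem_principalCoherentFamilies h24iii h25 hK ιK h𝔤0 hv hvv' hw hπ hα0 hα𝔪 hαw hαπ E hmono c
                  (fun i ↦ hE (i + c)) hdegEc b.2.1 b.2.2.1 (fun i ↦ hinert₀ (i + 1)) hcount (x b) (hx b)))
              (one_mem_closure_unitsGen hπ E _) (mul_mem_closure_unitsGen hπ E _) (inv_mem_closure_unitsGen hπ E _)
              (galAct_mem_closure_unitsGen hπ E _ (galAct_mem_closure_unitsGen_of_mul_rule hπ E hmono _ σ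
                (happrox_of_isLocArtinLiftable h𝔤0 hv hvv' hw hπ hα0 hα𝔪 hαw hαπ E hmono hE c hdegEc hinert₀ hcount σ hσ)
                (fun a b ↦ ⟨a.1 * b.1, a.2.mul b.2⟩)
                (fun b ↦ Ideal.absNorm (b.1 : Ideal (𝓞 K)))
                (hrule_ellipticUnitsPrincipal₂ h24iii h25 hK ιK h𝔤0 hv hvv' hw hπ hα0 hα𝔪 hαw hαπ E hmono c (fun i ↦ hE (i + c)) hdegEc h24ii
                  Subtype.val (fun a b ↦ ⟨a.1 * b.1, a.2.mul b.2⟩) (fun _ _ ↦ rfl) (fun a ↦ a.2.1) (fun a ↦ a.2.2.1) x hx σ hσ))))) =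
      Ideal.span {L} :=
  charIdeal_coinvariants_colemanImageTrace_closure_ellipticUnits_eq_span h24iii h25 h24ii hK ιK h𝔤0 hv hvv' hw hπ hα0 hα𝔪 hαw hαπ hd E hmono hE
    hdeg hσ₀ hq u hu γ w hγ hθ hcoh hI hud hm hN c hdegEc (fun i ↦ hinert₀ (i + 1)) hcount Subtype.val (fun a b ↦ ⟨a.1 * b.1, a.2.mul b.2⟩) (fun _ _ ↦ rfl)
    (fun a ↦ a.2.1) (fun a ↦ a.2.2.1) x hx σ hσ (happrox_of_isLocArtinLiftable h𝔤0 hv hvv' hw hπ hα0 hα𝔪 hαw hαπ E hmono hE c hdegEc hinert₀ hcount σ hσ)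
    ε g hε a₁ a₂ hv₁ hn₁ ha₂ L hL0 hL

end CapstoneLiftable

end Summit.BirchSwinnertonDyer.BirchSwinnertonDyer.Theorems.PrintCf2.ColemanCoinvariantTraceEllipticUnits

end
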